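/-
Copyright: lit-balaban cell, Phase-2 proof seat p24 (gen 25).  Released under Apache 2.0 license as described in the
file LICENSE.
-/
import Literature.MathematicalPhysics.QuantumFieldTheory.Balaban1983to89.B4Thm110ZeroLattice

/-!
# `Balaban1983to89.B4Eq16ZeroLatticeL2Operator` — [Balaban1983RegularityDecay] (1.6) + (1.8) FOR `Ω = ηℤ^{d+1}`, `A = 0`, AS AN
# EVERYWHERE-DEFINED BOUNDED OPERATOR ON `ℓ²(ηℤ^{d+1})`: for every square-summable `f`, `G_k(0)f` (p. 433 of
# [Balaban1983Higgs3]) converges absolutely, lies in `ℓ²` (Schur's test from (1.10)), satisfies `D(G_k(0)f) = f`, obeys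
# `‖G_k(0)f‖₂ ≤ (min{8,a_k} + m²)^{−1}‖f‖₂`, and is THE square-summable solution — every `m² ≥ 0`

statement-level skeleton of published theorems with citation tags; proofs where landed; nothing here is a claim about
the Yang–Mills mass gap

v1.1 (p24 gen 26, 2026-08-25): DOCSTRING-ONLY — (1.8) is now quoted with its Neumann superscript `N` and its «for e
sufficiently small and for a regular vector field A» proviso (referee ref-4 D-g103-1); no declaration, statement or proof changed.

CITATION HEADER.  T. Bałaban, *Regularity and decay of lattice Green's functions*, Commun. Math. Phys. **89** (1983)
571–597, doi:10.1007/bf01214744 [Balaban1983RegularityDecay] (cell paper B4; held text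
`paper:balaban1983-cmp89-regularity-decay`, journal page = PDF page + 570): p. 572 [PDF 2] (1.6), p. 573 [PDF 3] (1.8) and
the Theorem (1.10), p. 578 [PDF 8] Lemma 2.2 (2.17), p. 580 [PDF 10] (2.28), p. 584 [PDF 14] (2.44); [Balaban1983Higgs3]
p. 433 [PDF 23].  Unit `lit-balaban-p24` gen 25; HOME `run/shared/lean/pub/lit-balaban/`; SKELETON rows **B4.Eq1.6**,
**B4.Eq1.8**, **B4.Eq2.27** ((2.28)) (owner r01) and **B3.Txt@433** (owner r15) — cells only, proved-headed.  Closes the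
first item of p03 g8's `B3GkZeroLattice` honest scope (ii) («not as a bounded operator on ℓ²(ηℤ^{d+1})»); companion of
`B4Thm110ZeroLattice` (columns ∕ finitely supported data: `eq_GkLat_col_of_opD_eq`, `GkLat_apply_finsupp`,
`GkLat_apply_l2_bound`) and of `B4Eq16ZeroLatticeBounded` (the `ℓ^∞` inverse).  Builds on `B4Thm110ZeroLattice` only.

WHAT IS PRINTED.  [B4] p. 572: «G_k(Ω, A) = (−Δ^{η,N}_{A,Ω} + m² + aP_k(A))^{−1}, (1.6) where m² ≧ 0 and a is a positive
constant».  p. 573: «The operator defining the Green's function (1.6) has a strictly positive lower bound. More exactly we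
prove that there exists a positive constant γ₀ such that for e sufficiently small and for a regular vector field A
−Δ^{η,N}_{A,Ω} + aP_k(A) ≧ γ₀I. (1.8) The constant γ₀ is independent
of the lattice spacing η, as well as of Ω and of A. This bound justifies the definition (1.6) and explains exponential decay
properties.»  [B3] p. 433: «we substitute G_k(□,0) = G_k(0) + δG_k(□,ηZ^d,0)».

WHAT THIS MODULE PROVES (kernel-checked; theorems only; 0 `def`; 0 `sorry`; axioms standard), for every `k ≥ 1`, `a > 0`,
`m² ≥ 0` (`n = L^k`, running coefficient `a_k = B1.aSeq a L k > 0`, `D = B4Green244.opD n a_k m²`, `G_k(0) = GkLat`, complex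
square-summable data `f`, `(G_k(0)f)(x) = Σ_zG_k(0)(x,z)f(z)`):
* `GkLat_apply_l2_summable` — the series converges absolutely at every `x` (rows of `G_k(0)` summable, entries bounded).
* `GkLat_apply_l2_sq_summable` — SCHUR'S TEST: `G_k(0)f ∈ ℓ²`, `Σ_x|(G_k(0)f)(x)|² ≤ c₀²Σ_z|f(z)|²`, `c₀` a window constant
  bounding the row sums, the column sums (`GkLat_comm`) and the entries of `|G_k(0)|` (`B4Thm110ZeroLattice.GkLat_weightedRow_le`,
  i.e. (1.10) ∕ Lemma 2.2 at `p = q ∈ {1,∞}`); Cauchy–Schwarz with the weight `|G_k(0)(x,·)|`, finite windows first, then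
  `summable_of_sum_le` ∕ `Real.tsum_le_of_sum_le`.
* `opD_GkLat_apply_l2` — `D(G_k(0)f) = f` on all of `ℤ^{d+1}` (finite stencil `B4Green242Bridge.opK_dictionary` exchanged with
  the series; `DG_k(0)(·,z) = δ_z`, `B4Thm110ZeroLattice.opD_GkLat_col`).
* `eq_GkLat_apply_of_l2_solution` — every square-summable `ψ` with `Dψ = f` IS `G_k(0)f`
  (`B4Ineq227LatticeL2.opD_injective_l2_of_pos`, `min{8,a_k} + m² > 0`).
* `GkLat_l2_norm_le` — THE SHARP BOUND `(min{8,a_k} + m²)‖G_k(0)f‖₂ ≤ ‖f‖₂` ((1.8)/(2.28) on the whole lattice: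
  `B4Ineq227LatticeL2.norm_opD_ge` applied to `φ = G_k(0)f ∈ ℓ²`, `Dφ = f`); summary `GkLat_inverse_l2`.
* Non-vacuity at `d + 1 = 4`, `L = 2`, `m² = 0`, datum `δ₀`.

DICTIONARY / HONEST SCOPE.  (i) `A = 0`, one component, `Ω = ηℤ^{d+1}` (no boundary, no Neumann condition to state); the
lineage's units (matrix units for `G_k(0)`; the `ℓ²` norms are the unweighted `Σ|·|²` — for an operator bound on the same
lattice the weights `η^{d+1}` cancel).  (ii) The print's `γ₀` of (1.8) is for general regular `A` and `Ω`; here only the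
zero-field whole-lattice instance with the explicit constant `min{8,a_k} + m²` of `B4Ineq227LatticeL2` (gen 24), and the
Schur constant `c₀` (existential, window-dependent).  (iii) No `lp`-space ∕ `ContinuousLinearMap` packaging: statements are
on functions with `Summable (‖·‖²)`.  (iv) Value = (1.6) as an everywhere-defined bounded inverse on
`ℓ²(ηℤ^{d+1})` for the free infinite-lattice propagator, with the (1.8) bound; cells only; NOT summit progress.
-/

namespace Literature.MathematicalPhysics.QuantumFieldTheory.Balaban1983to89.B4Eq16ZeroLatticeL2Operator

open Finset Filter Topology Complex
open Literature.MathematicalPhysics.QuantumFieldTheory.Balaban1983to89.B4ContourShift (supNorm supNorm_nonneg)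
open Literature.MathematicalPhysics.QuantumFieldTheory.Balaban1983to89.B4Reflection242 (opK opSupp)
open Literature.MathematicalPhysics.QuantumFieldTheory.Balaban1983to89.B3GkZeroLattice (GkLat GkLat_comm)
open Literature.MathematicalPhysics.QuantumFieldTheory.Balaban1983to89.B4Green244 (opD)
open Literature.MathematicalPhysics.QuantumFieldTheory.Balaban1983to89.B4Green242Bridge (opK_dictionary)
open Literature.MathematicalPhysics.QuantumFieldTheory.Balaban1983to89.B4Thm110ZeroBox (one_lt_L_real)
open Literature.MathematicalPhysics.QuantumFieldTheory.Balaban1983to89.B4Ineq227LatticeL2 (opD_injective_l2_of_pos norm_opD_ge)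
open Literature.MathematicalPhysics.QuantumFieldTheory.Balaban1983to89.B4Thm110ZeroLattice

noncomputable section

variable {d : ℕ}

/-! ## §0 Kernel helpers -/

/-- kernel: `L^k ≥ 1`. [folklore] -/
private theorem one_le_n (ℓ k : ℕ) : 1 ≤ (ℓ + 1) ^ k := Nat.one_le_pow _ _ (by omega)

/-- kernel: Cauchy–Schwarz with a weight on a finite set: `(Σ a·b)² ≤ (Σ a)·(Σ a·b²)` for `a ≥ 0`. [folklore] -/
private theorem sq_sum_mul_le {ι : Type*} (s : Finset ι) (a b : ι → ℝ) (ha : ∀ i, 0 ≤ a i) :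
    (∑ i ∈ s, a i * b i) ^ 2 ≤ (∑ i ∈ s, a i) * ∑ i ∈ s, a i * b i ^ 2 := by
  have h := Finset.sum_mul_sq_le_sq_mul_sq s (fun i => Real.sqrt (a i)) (fun i => Real.sqrt (a i) * b i)
  have h1 : ∀ i, Real.sqrt (a i) * (Real.sqrt (a i) * b i) = a i * b i := fun i => by
    rw [← mul_assoc, Real.mul_self_sqrt (ha i)]
  have h2 : ∀ i, Real.sqrt (a i) ^ 2 = a i := fun i => Real.sq_sqrt (ha i)
  have h3 : ∀ i, (Real.sqrt (a i) * b i) ^ 2 = a i * b i ^ 2 := fun i => by rw [mul_pow, h2]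
  simp only [h1, h2, h3] at h
  exact h

section L2

variable {ℓ k : ℕ} {a m2 : ℝ}

/-- kernel: ONE window constant for the point `(a, m²)`: plain row sums, plain column sums and entries of `|G_k(0)|` are
`≤ c₀` (`B4Thm110ZeroLattice.GkLat_weightedRow_le` at the window `[a,a] × [m²,m²]`, weights `≥ 1`, symmetry `GkLat_comm`).
[cite: Balaban1983RegularityDecay, Theorem (1.10) p.573, Lemma 2.2 (2.17) p.578; dictionary (Ω = ηℤ^{d+1}, A = 0)] -/
private theorem window (hℓ : 1 ≤ ℓ) (hk : 1 ≤ k) (ha : 0 < a) (hm : 0 ≤ m2) :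
    ∃ c₀ : ℝ, 0 < c₀ ∧
      (∀ (x : Fin (d + 1) → ℤ) (F : Finset (Fin (d + 1) → ℤ)), ∑ z ∈ F, |GkLat ℓ k a m2 x z| ≤ c₀) ∧
      (∀ (z : Fin (d + 1) → ℤ) (F : Finset (Fin (d + 1) → ℤ)), ∑ x ∈ F, |GkLat ℓ k a m2 x z| ≤ c₀) ∧
      (∀ x z : Fin (d + 1) → ℤ, |GkLat ℓ k a m2 x z| ≤ c₀) ∧
      ∀ x : Fin (d + 1) → ℤ, Summable fun z => |GkLat ℓ k a m2 x z| := by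
  obtain ⟨δ₀, c₀, hδ₀, hc₀, h⟩ := GkLat_weightedRow_le d ℓ hℓ a a m2 ha
  have hw : ∀ x z : Fin (d + 1) → ℤ, |GkLat ℓ k a m2 x z|
      ≤ |GkLat ℓ k a m2 x z| * Real.exp (δ₀ * supNorm (x - z) / (((ℓ + 1) ^ k : ℕ) : ℝ)) := fun x z =>
    le_mul_of_one_le_right (abs_nonneg _)
      (Real.one_le_exp (div_nonneg (mul_nonneg hδ₀.le (supNorm_nonneg _)) (Nat.cast_nonneg _)))
  have hrow : ∀ (x : Fin (d + 1) → ℤ) (F : Finset (Fin (d + 1) → ℤ)), ∑ z ∈ F, |GkLat ℓ k a m2 x z| ≤ c₀ :=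
    fun x F => (Finset.sum_le_sum fun z _ => hw x z).trans (h k hk a m2 le_rfl le_rfl hm le_rfl x F)
  refine ⟨c₀, hc₀, hrow, fun z F => ?_, fun x z => ?_, fun x => ?_⟩
  · simp_rw [GkLat_comm _ z]
    exact hrow z F
  · have := hrow x {z}
    rwa [Finset.sum_singleton] at this
  · exact (GkLat_row_summable hδ₀.le (h k hk a m2 le_rfl le_rfl hm le_rfl x)).1

/-- kernel: for `f ∈ ℓ²`, the row of `|G_k(0)|` against `‖f‖` and against `‖f‖²` is summable. [folklore] -/
private theorem summable_row_mul (hℓ : 1 ≤ ℓ) (hk : 1 ≤ k) (ha : 0 < a) (hm : 0 ≤ m2)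
    {f : (Fin (d + 1) → ℤ) → ℂ} (hf : Summable fun z => ‖f z‖ ^ 2) (x : Fin (d + 1) → ℤ) :
    (Summable fun z => |GkLat ℓ k a m2 x z| * ‖f z‖ ^ 2) ∧ Summable fun z => |GkLat ℓ k a m2 x z| * ‖f z‖ := by
  obtain ⟨c₀, hc₀, -, -, habs, hrs⟩ := window (d := d) hℓ hk ha hm
  have h1 : Summable fun z => |GkLat ℓ k a m2 x z| * ‖f z‖ ^ 2 :=
    Summable.of_nonneg_of_le (fun z => mul_nonneg (abs_nonneg _) (sq_nonneg _))
      (fun z => mul_le_mul_of_nonneg_right (habs x z) (sq_nonneg _)) (hf.mul_left c₀)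
  refine ⟨h1, Summable.of_nonneg_of_le (fun z => mul_nonneg (abs_nonneg _) (norm_nonneg _)) (fun z => ?_)
    ((hrs x).add h1)⟩
  -- `|G|·‖f‖ ≤ |G| + |G|·‖f‖²` since `t ≤ 1 + t²`
  have ht : ‖f z‖ ≤ 1 + ‖f z‖ ^ 2 := by nlinarith [norm_nonneg (f z), sq_nonneg (‖f z‖ - 1)]
  calc |GkLat ℓ k a m2 x z| * ‖f z‖ ≤ |GkLat ℓ k a m2 x z| * (1 + ‖f z‖ ^ 2) :=
        mul_le_mul_of_nonneg_left ht (abs_nonneg _)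
    _ = |GkLat ℓ k a m2 x z| + |GkLat ℓ k a m2 x z| * ‖f z‖ ^ 2 := by ring

/-- **`G_k(0)f` IS DEFINED ON ALL OF `ℓ²(ηℤ^{d+1})`**: for square-summable `f` and every `x` the series
`(G_k(0)f)(x) = Σ_z G_k(0)(x,z)f(z)` converges absolutely (the rows of `G_k(0)` are summable, hence square-summable).
[cite: Balaban1983RegularityDecay, (1.6) p.572, Theorem (1.10) p.573; dictionary (Ω = ηℤ^{d+1}, A = 0)] -/
theorem GkLat_apply_l2_summable (hℓ : 1 ≤ ℓ) (hk : 1 ≤ k) (ha : 0 < a) (hm : 0 ≤ m2)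
    {f : (Fin (d + 1) → ℤ) → ℂ} (hf : Summable fun z => ‖f z‖ ^ 2) (x : Fin (d + 1) → ℤ) :
    Summable fun z => ((GkLat ℓ k a m2 x z : ℝ) : ℂ) * f z := by
  refine Summable.of_norm ((summable_row_mul hℓ hk ha hm hf x).2.congr fun z => ?_)
  rw [norm_mul, Complex.norm_real, Real.norm_eq_abs]

/-- **SCHUR'S BOUND, POINTWISE**: for `f ∈ ℓ²`, `|(G_k(0)f)(x)|² ≤ c₀·Σ_z|G_k(0)(x,z)|·|f(z)|²` with the window constant `c₀`
(row sums `≤ c₀`; Cauchy–Schwarz with the weight `|G_k(0)(x,·)|`). [folklore] -/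
private theorem normSq_apply_le {c₀ : ℝ}
    (hrow : ∀ (x : Fin (d + 1) → ℤ) (F : Finset (Fin (d + 1) → ℤ)), ∑ z ∈ F, |GkLat ℓ k a m2 x z| ≤ c₀)
    {f : (Fin (d + 1) → ℤ) → ℂ} (x : Fin (d + 1) → ℤ)
    (h1 : Summable fun z => |GkLat ℓ k a m2 x z| * ‖f z‖ ^ 2) (h2 : Summable fun z => |GkLat ℓ k a m2 x z| * ‖f z‖) :
    ‖∑' z, ((GkLat ℓ k a m2 x z : ℝ) : ℂ) * f z‖ ^ 2 ≤ c₀ * ∑' z, |GkLat ℓ k a m2 x z| * ‖f z‖ ^ 2 := by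
  set U : ℝ := ∑' z, |GkLat ℓ k a m2 x z| * ‖f z‖ ^ 2 with hU
  have hU0 : 0 ≤ U := tsum_nonneg fun z => mul_nonneg (abs_nonneg _) (sq_nonneg _)
  have hc0 : 0 ≤ c₀ := le_trans (Finset.sum_nonneg fun _ _ => abs_nonneg _) (hrow x ∅)
  -- the finite partial sums of `Σ|G|‖f‖` are `≤ √(c₀U)`
  have hfin : ∀ F : Finset (Fin (d + 1) → ℤ), ∑ z ∈ F, |GkLat ℓ k a m2 x z| * ‖f z‖ ≤ Real.sqrt (c₀ * U) := by
    intro F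
    have hS0 : 0 ≤ ∑ z ∈ F, |GkLat ℓ k a m2 x z| * ‖f z‖ :=
      Finset.sum_nonneg fun z _ => mul_nonneg (abs_nonneg _) (norm_nonneg _)
    refine Real.le_sqrt_of_sq_le ?_
    calc (∑ z ∈ F, |GkLat ℓ k a m2 x z| * ‖f z‖) ^ 2
        ≤ (∑ z ∈ F, |GkLat ℓ k a m2 x z|) * ∑ z ∈ F, |GkLat ℓ k a m2 x z| * ‖f z‖ ^ 2 :=
          sq_sum_mul_le F _ _ fun z => abs_nonneg _
      _ ≤ c₀ * U := mul_le_mul (hrow x F)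
          (h1.sum_le_tsum F (fun z _ => mul_nonneg (abs_nonneg _) (sq_nonneg _)))
          (Finset.sum_nonneg fun z _ => mul_nonneg (abs_nonneg _) (sq_nonneg _)) hc0
  have hT : ∑' z, |GkLat ℓ k a m2 x z| * ‖f z‖ ≤ Real.sqrt (c₀ * U) :=
    Real.tsum_le_of_sum_le (fun z => mul_nonneg (abs_nonneg _) (norm_nonneg _)) hfin
  have hN : ‖∑' z, ((GkLat ℓ k a m2 x z : ℝ) : ℂ) * f z‖ ≤ ∑' z, |GkLat ℓ k a m2 x z| * ‖f z‖ := by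
    refine (norm_tsum_le_tsum_norm (h2.congr fun z => ?_)).trans (le_of_eq (tsum_congr fun z => ?_))
    all_goals rw [norm_mul, Complex.norm_real, Real.norm_eq_abs]
  have hT0 : 0 ≤ ∑' z, |GkLat ℓ k a m2 x z| * ‖f z‖ := tsum_nonneg fun z => mul_nonneg (abs_nonneg _) (norm_nonneg _)
  calc ‖∑' z, ((GkLat ℓ k a m2 x z : ℝ) : ℂ) * f z‖ ^ 2 ≤ (∑' z, |GkLat ℓ k a m2 x z| * ‖f z‖) ^ 2 :=
        pow_le_pow_left₀ (norm_nonneg _) hN 2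
    _ ≤ Real.sqrt (c₀ * U) ^ 2 := pow_le_pow_left₀ hT0 hT 2
    _ = c₀ * U := Real.sq_sqrt (mul_nonneg hc0 hU0)

/-- **`G_k(0)` IS A BOUNDED OPERATOR ON `ℓ²(ηℤ^{d+1})` (SCHUR'S TEST)**: for `f ∈ ℓ²`, `G_k(0)f ∈ ℓ²` and
`Σ_x|(G_k(0)f)(x)|² ≤ c₀²·Σ_z|f(z)|²`, `c₀` a window constant bounding the row and the column sums of `|G_k(0)|` ((1.10),
Lemma 2.2 at `p = q = 1, ∞`) — «−Δ^{η,N}_{A,Ω} + aP_k(A) ≧ γ₀I. (1.8) … This bound justifies the definition (1.6)», here on the whole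
lattice and from the decay alone; the sharp constant `(min{8,a_k} + m²)^{−1}` follows in `GkLat_l2_norm_le`.
[cite: Balaban1983RegularityDecay, (1.6) p.572, (1.8)/(1.10) p.573, Lemma 2.2 (2.17) p.578; dictionary (Ω = ηℤ^{d+1}, A = 0)] -/
theorem GkLat_apply_l2_sq_summable (hℓ : 1 ≤ ℓ) (hk : 1 ≤ k) (ha : 0 < a) (hm : 0 ≤ m2) :
    ∃ c₀ : ℝ, 0 < c₀ ∧ ∀ {f : (Fin (d + 1) → ℤ) → ℂ}, (Summable fun z => ‖f z‖ ^ 2) →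
      (Summable fun x => ‖∑' z, ((GkLat ℓ k a m2 x z : ℝ) : ℂ) * f z‖ ^ 2) ∧
        ∑' x, ‖∑' z, ((GkLat ℓ k a m2 x z : ℝ) : ℂ) * f z‖ ^ 2 ≤ c₀ ^ 2 * ∑' z, ‖f z‖ ^ 2 := by
  obtain ⟨c₀, hc₀, hrow, hcol, habs, hrs⟩ := window (d := d) hℓ hk ha hm
  refine ⟨c₀, hc₀, fun {f} hf => ?_⟩
  have hrm := fun x => summable_row_mul (d := d) hℓ hk ha hm hf x
  -- the partial sums over finite output windows
  have hwin : ∀ Λ : Finset (Fin (d + 1) → ℤ),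
      ∑ x ∈ Λ, ‖∑' z, ((GkLat ℓ k a m2 x z : ℝ) : ℂ) * f z‖ ^ 2 ≤ c₀ ^ 2 * ∑' z, ‖f z‖ ^ 2 := by
    intro Λ
    have hpt : ∀ x ∈ Λ, ‖∑' z, ((GkLat ℓ k a m2 x z : ℝ) : ℂ) * f z‖ ^ 2
        ≤ c₀ * ∑' z, |GkLat ℓ k a m2 x z| * ‖f z‖ ^ 2 := fun x _ => normSq_apply_le hrow x (hrm x).1 (hrm x).2
    -- exchange the finite sum over `x` with the series over `z`
    have hex : ∑ x ∈ Λ, ∑' z, |GkLat ℓ k a m2 x z| * ‖f z‖ ^ 2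
        = ∑' z, (∑ x ∈ Λ, |GkLat ℓ k a m2 x z|) * ‖f z‖ ^ 2 := by
      rw [← (hasSum_sum fun x (_ : x ∈ Λ) => (hrm x).1.hasSum).tsum_eq]
      exact tsum_congr fun z => by rw [Finset.sum_mul]
    have hcmp : ∑' z, (∑ x ∈ Λ, |GkLat ℓ k a m2 x z|) * ‖f z‖ ^ 2 ≤ ∑' z, c₀ * ‖f z‖ ^ 2 := by
      refine Summable.tsum_le_tsum (fun z => mul_le_mul_of_nonneg_right (hcol z Λ) (sq_nonneg _)) ?_ (hf.mul_left c₀)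
      have : Summable fun z => ∑ x ∈ Λ, |GkLat ℓ k a m2 x z| * ‖f z‖ ^ 2 := summable_sum fun x _ => (hrm x).1
      exact this.congr fun z => by rw [Finset.sum_mul]
    calc ∑ x ∈ Λ, ‖∑' z, ((GkLat ℓ k a m2 x z : ℝ) : ℂ) * f z‖ ^ 2
        ≤ ∑ x ∈ Λ, c₀ * ∑' z, |GkLat ℓ k a m2 x z| * ‖f z‖ ^ 2 := Finset.sum_le_sum hpt
      _ = c₀ * ∑' z, (∑ x ∈ Λ, |GkLat ℓ k a m2 x z|) * ‖f z‖ ^ 2 := by rw [← Finset.mul_sum, hex]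
      _ ≤ c₀ * ∑' z, c₀ * ‖f z‖ ^ 2 := mul_le_mul_of_nonneg_left hcmp hc₀.le
      _ = c₀ ^ 2 * ∑' z, ‖f z‖ ^ 2 := by rw [tsum_mul_left]; ring
  exact ⟨summable_of_sum_le (fun _ => sq_nonneg _) hwin, Real.tsum_le_of_sum_le (fun _ => sq_nonneg _) hwin⟩

/-- **`D(G_k(0)f) = f` FOR EVERY `f ∈ ℓ²(ηℤ^{d+1})`** (`D = −Δ^ξ + m² + a_kQ_k^*Q_k`): the finite stencil of `D`
(`B4Green242Bridge.opK_dictionary`) commutes with the absolutely convergent series and `DG_k(0)(·,z) = δ_z`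
(`B4Thm110ZeroLattice.opD_GkLat_col`) — «G_k(Ω, A) = (−Δ^{η,N}_{A,Ω} + m² + aP_k(A))^{−1} (1.6)» on `ℓ²`, `Ω = ηℤ^{d+1}`, `A = 0`.
[cite: Balaban1983RegularityDecay, (1.6) p.572, (2.44) p.584; dictionary (Ω = ηℤ^{d+1}, A = 0)] -/
theorem opD_GkLat_apply_l2 (hℓ : 1 ≤ ℓ) (hk : 1 ≤ k) (ha : 0 < a) (hm : 0 ≤ m2)
    {f : (Fin (d + 1) → ℤ) → ℂ} (hf : Summable fun z => ‖f z‖ ^ 2) (x : Fin (d + 1) → ℤ) :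
    opD ((ℓ + 1) ^ k) (B1.aSeq a ((ℓ : ℝ) + 1) k) m2
      (fun w => ∑' z, ((GkLat ℓ k a m2 w z : ℝ) : ℂ) * f z) x = f x := by
  classical
  haveI : NeZero ((ℓ + 1) ^ k) := ⟨pow_ne_zero _ (Nat.succ_ne_zero ℓ)⟩
  have hsum : ∀ w, Summable fun z => ((GkLat ℓ k a m2 w z : ℝ) : ℂ) * f z :=
    fun w => GkLat_apply_l2_summable hℓ hk ha hm hf w
  set n : ℕ := (ℓ + 1) ^ k with hn
  set K : (Fin (d + 1) → ℤ) → (Fin (d + 1) → ℤ) → ℂ :=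
    opK (((n : ℕ) : ℂ) ^ 2) (m2 : ℂ) (((B1.aSeq a ((ℓ : ℝ) + 1) k : ℝ) : ℂ) * (((n : ℕ) : ℂ) ^ (d + 1))⁻¹) n with hK
  rw [← opK_dictionary n (one_le_n ℓ k)]
  have hswap : ∑ w ∈ opSupp n x, K x w * ∑' z, ((GkLat ℓ k a m2 w z : ℝ) : ℂ) * f z
      = ∑' z, ∑ w ∈ opSupp n x, K x w * (((GkLat ℓ k a m2 w z : ℝ) : ℂ) * f z) := by
    rw [(hasSum_sum fun w _ => ((hsum w).hasSum.mul_left (K x w))).tsum_eq]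
  rw [hswap]
  have hinner : ∀ z, ∑ w ∈ opSupp n x, K x w * (((GkLat ℓ k a m2 w z : ℝ) : ℂ) * f z)
      = (if x = z then 1 else 0) * f z := by
    intro z
    simp_rw [← mul_assoc]
    rw [← Finset.sum_mul, hK, hn, opK_dictionary ((ℓ + 1) ^ k) (one_le_n ℓ k), opD_GkLat_col hℓ hk ha hm z x]
  simp_rw [hinner]
  rw [tsum_eq_single x (fun z hz => by rw [if_neg (Ne.symm hz), zero_mul])]
  rw [if_pos rfl, one_mul]

/-- **UNIQUENESS: EVERY SQUARE-SUMMABLE SOLUTION OF `Dψ = f` (`f ∈ ℓ²`) IS `G_k(0)f`** (`B4Ineq227LatticeL2.opD_injective_l2_of_pos`,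
`min{8,a_k} + m² > 0`, every `m² ≥ 0`). [cite: Balaban1983RegularityDecay, (1.6) p.572, (1.8) p.573; dictionary (Ω = ηℤ^{d+1}, A = 0)] -/
theorem eq_GkLat_apply_of_l2_solution (hℓ : 1 ≤ ℓ) (hk : 1 ≤ k) (ha : 0 < a) (hm : 0 ≤ m2)
    {f ψ : (Fin (d + 1) → ℤ) → ℂ} (hf : Summable fun z => ‖f z‖ ^ 2) (hψ2 : Summable fun z => ‖ψ z‖ ^ 2)
    (hψ : ∀ z, opD ((ℓ + 1) ^ k) (B1.aSeq a ((ℓ : ℝ) + 1) k) m2 ψ z = f z) :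
    ψ = fun x => ∑' z, ((GkLat ℓ k a m2 x z : ℝ) : ℂ) * f z := by
  haveI : NeZero ((ℓ + 1) ^ k) := ⟨pow_ne_zero _ (Nat.succ_ne_zero ℓ)⟩
  have hak : 0 < B1.aSeq a ((ℓ : ℝ) + 1) k := B1.aSeq_pos ha (one_lt_L_real hℓ) hk
  have hγ : 0 < min 8 (B1.aSeq a ((ℓ : ℝ) + 1) k) + m2 := add_pos_of_pos_of_nonneg (lt_min (by norm_num) hak) hm
  obtain ⟨c₀, -, hc⟩ := GkLat_apply_l2_sq_summable (d := d) hℓ hk ha hm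
  exact opD_injective_l2_of_pos ((ℓ + 1) ^ k) hak.le hm hγ hψ2 (hc hf).1 fun z => by
    rw [hψ z, opD_GkLat_apply_l2 hℓ hk ha hm hf z]

/-- **THE SHARP OPERATOR BOUND ON `ℓ²`**: `(min{8,a_k} + m²)·‖G_k(0)f‖₂ ≤ ‖f‖₂` for every `f ∈ ℓ²(ηℤ^{d+1})` — (1.8)/(2.28) for
the whole-lattice propagator as an everywhere-defined bounded operator (`B4Ineq227LatticeL2.norm_opD_ge` applied to
`φ = G_k(0)f ∈ ℓ²`, `Dφ = f`). [cite: Balaban1983RegularityDecay, (1.8) p.573 («−Δ^{η,N}_{A,Ω} + aP_k(A) ≧ γ₀I … This bound justifies the definition (1.6)»), (2.28) p.580; dictionary (Ω = ηℤ^{d+1}, A = 0)] -/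
theorem GkLat_l2_norm_le (hℓ : 1 ≤ ℓ) (hk : 1 ≤ k) (ha : 0 < a) (hm : 0 ≤ m2)
    {f : (Fin (d + 1) → ℤ) → ℂ} (hf : Summable fun z => ‖f z‖ ^ 2) :
    (min 8 (B1.aSeq a ((ℓ : ℝ) + 1) k) + m2) * Real.sqrt (∑' x, ‖∑' z, ((GkLat ℓ k a m2 x z : ℝ) : ℂ) * f z‖ ^ 2)
      ≤ Real.sqrt (∑' z, ‖f z‖ ^ 2) := by
  haveI : NeZero ((ℓ + 1) ^ k) := ⟨pow_ne_zero _ (Nat.succ_ne_zero ℓ)⟩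
  have hak : 0 < B1.aSeq a ((ℓ : ℝ) + 1) k := B1.aSeq_pos ha (one_lt_L_real hℓ) hk
  obtain ⟨c₀, -, hc⟩ := GkLat_apply_l2_sq_summable (d := d) hℓ hk ha hm
  have h := norm_opD_ge ((ℓ + 1) ^ k) hak.le hm (hc hf).1
  simp_rw [opD_GkLat_apply_l2 hℓ hk ha hm hf] at h
  exact h

/-- **`G_k(0)` IS THE BOUNDED INVERSE (1.6) ON `ℓ²(ηℤ^{d+1})`** (summary): for every square-summable `f`, `G_k(0)f` is an
absolutely convergent series at every point, lies in `ℓ²` with `‖G_k(0)f‖₂ ≤ (min{8,a_k} + m²)^{−1}‖f‖₂`, solves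
`D(G_k(0)f) = f`, and is the only square-summable solution — every `k ≥ 1`, `a > 0`, `m² ≥ 0`.
[cite: Balaban1983RegularityDecay, (1.6) p.572, (1.8) p.573; Balaban1983Higgs3, p.433; dictionary (Ω = ηℤ^{d+1}, A = 0)] -/
theorem GkLat_inverse_l2 (hℓ : 1 ≤ ℓ) (hk : 1 ≤ k) (ha : 0 < a) (hm : 0 ≤ m2)
    {f : (Fin (d + 1) → ℤ) → ℂ} (hf : Summable fun z => ‖f z‖ ^ 2) :
    (∀ x, Summable fun z => ((GkLat ℓ k a m2 x z : ℝ) : ℂ) * f z) ∧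
    (Summable fun x => ‖∑' z, ((GkLat ℓ k a m2 x z : ℝ) : ℂ) * f z‖ ^ 2) ∧
    (min 8 (B1.aSeq a ((ℓ : ℝ) + 1) k) + m2) * Real.sqrt (∑' x, ‖∑' z, ((GkLat ℓ k a m2 x z : ℝ) : ℂ) * f z‖ ^ 2)
      ≤ Real.sqrt (∑' z, ‖f z‖ ^ 2) ∧
    (∀ x, opD ((ℓ + 1) ^ k) (B1.aSeq a ((ℓ : ℝ) + 1) k) m2
      (fun w => ∑' z, ((GkLat ℓ k a m2 w z : ℝ) : ℂ) * f z) x = f x) ∧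
    ∀ ψ : (Fin (d + 1) → ℤ) → ℂ, (Summable fun z => ‖ψ z‖ ^ 2) →
      (∀ z, opD ((ℓ + 1) ^ k) (B1.aSeq a ((ℓ : ℝ) + 1) k) m2 ψ z = f z) →
        ψ = fun x => ∑' z, ((GkLat ℓ k a m2 x z : ℝ) : ℂ) * f z := by
  obtain ⟨c₀, -, hc⟩ := GkLat_apply_l2_sq_summable (d := d) hℓ hk ha hm
  exact ⟨fun x => GkLat_apply_l2_summable hℓ hk ha hm hf x, (hc hf).1, GkLat_l2_norm_le hℓ hk ha hm hf,
    fun x => opD_GkLat_apply_l2 hℓ hk ha hm hf x,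
    fun ψ hψ2 hψ => eq_GkLat_apply_of_l2_solution hℓ hk ha hm hf hψ2 hψ⟩

end L2

/-! ## Non-vacuity (`d + 1 = 4`, `L = 2`, `k = 1`, `a = 1`, `m² = 0`) -/

/-- the `ℓ²` inverse statement at the physical dimension, massless, for the square-summable datum `δ₀`. -/
example : ∀ x : Fin (3 + 1) → ℤ, opD ((1 + 1) ^ 1) (B1.aSeq 1 ((1 : ℕ) + 1 : ℝ) 1) 0
    (fun w => ∑' z, ((GkLat 1 1 1 0 w z : ℝ) : ℂ) * (if z = 0 then (1 : ℂ) else 0)) x = (if x = 0 then (1 : ℂ) else 0) :=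
  fun x => opD_GkLat_apply_l2 (d := 3) le_rfl le_rfl one_pos le_rfl
    (summable_of_ne_finset_zero (s := {0}) fun z hz => by
      rw [Finset.mem_singleton] at hz; simp [hz]) x

end

end Literature.MathematicalPhysics.QuantumFieldTheory.Balaban1983to89.B4Eq16ZeroLatticeL2Operator
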